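import Mathlib
import HarnessLib
import HarnessLib.Audit
import Summits.HodgeConjecture.HodgeConjecture.Theses.KleimanBFSeeds
import Summits.Ventures.HSemireg.SheafDoorBFModelResidual
import Literature.AlgebraicGeometry.HodgeTheory.SemiregularVariationalHodgeISemiregular
import Literature.AlgebraicGeometry.HodgeTheory.SemiregularReducedObstructions
import Literature.AlgebraicGeometry.HodgeTheory.LefschetzOneOne

/-!
# Skeleton `Lines/pridham-lifts-algebraise` for crux `BFVariationalHodge` (stmt-HodgeConjecture-25635)

HONEST FRAMING: a crux PROOF SKELETON (cruxes-workfile class), not a proof. The crux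
`Theses.KleimanBFSeeds.BFVariationalHodge = BuchweitzFlenner2003_variationalHodge_ISemiregular` (Buchweitz–Flenner 2003
Thm. 5.1, fixed-fibre rendering, every Chern character theory `C`; a refereed theorem typed as an open tree item —
formalisation debt) is NOT proved here: the `sorry`s sit exactly inside the registered `stub_*` declarations. Nothing
here proves K-C⁺, K2, rung H2, HC_AV or HC.

STRATEGY (line-writer seat `linewriter-hodgeav-h2sheaf` g0, 2026-08-31) — THE TWO PRINTED HALVES OF THE PROOF OF THM. 5.1
(p. 179), exactly as the venture's residual theorem
`Summit.Ventures.HSemireg.BuchweitzFlenner2003_variationalHodge_ISemiregular_and_semiregular_of_pridham_of_sheafDeformsOverEtaleNbhdOfLifts`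
(LANDED, `SheafDoorBFModelResidual.lean`) consumes them:

* `stub_pridhamLifts` — (F) INFINITESIMAL: an `I`-semiregular vector bundle whose Chern character stays of Hodge type
  `(p,p)` along `U` lifts over every Artinian thickening of `s₀` inside the Hodge locus («applying 5.9 repeatedly … `ℰ₀` can be
  lifted to `ℰ_n` on `X_n` for all `n`», BF Prop. 5.9 + Lemma 5.10), typed as Pridham's refereed reduced obstruction
  theory — tree named fact `Pridham2024_ISemiregular_liftsOverHodgeLocus_model` ([Pridham2024Semiregularity] Cor. 2.25,
  Rem. 2.27, Rem. 2.21 `𝓛 = σ`, Lemma 1.8). [XL: Atiyah class / trace obstruction calculus on the tree's real `σ_q`.]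
* `stub_sheafAlgebraises` — (E)+(C) HODGE-FREE: a vector bundle with the formal lifting property deforms over an ÉTALE
  neighbourhood of `s₀` with the right Chern character («Let `ℰ` be a versal deformation … by Artin's approximation theorem
  we can find a convergent section»), typed in the algebraic shape of [Perry2022] proof of Prop. 8.1 — venture assumption
  `∀ C, SheafDeformsOverEtaleNbhdOfLifts C` ([Lieblich2006] Thm. 4.2.1 stack of coherent sheaves; [EGAIV4] 17.14.2,
  17.16.3 (i); [Artin1969] Thm. 1.12). [XL: algebraic stacks / Artin approximation absent from Mathlib.]
* `stub_rung_lineBundles` — RUNG (special case, first prover target): the crux for INVERTIBLE `ℰ₀` (`HasRankLE E₀ 1`):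
  `ch(L) = exp(c₁(L))` (field `ch_of_hasRankLE_one` of `C`), `1 ∈ I` whenever `I ≠ ∅` is irrelevant here — if `ch₁(L) = c₁`
  stays `(1,1)` it is a divisor class on nearby fibres by Lefschetz (1,1) (tree named fact `lefschetzOneOne_rational`) and
  `ch_p = c₁^p/p!` is algebraic; if only higher `p ∈ I` are constrained the statement is Kodaira–Spencer's stability of
  semi-regular divisors read through `exp`. Outside the tree's proved regime (no cell of Thm. 5.1 is proved in the tree).
  `rung_of_crux` (sorry-free) shows it IS a special case.

COMPOSITION `BFVariationalHodge_of` (sorry-free given the stubs):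
`(…_and_semiregular_of_pridham_of_sheafDeformsOverEtaleNbhdOfLifts stub_pridhamLifts stub_sheafAlgebraises).1`.

References: [BuchweitzFlenner2003] §5 Thm. 5.1 (proof p. 179), Prop. 5.9, Lemma 5.10; [Pridham2024Semiregularity] Cor. 2.25,
Rem. 2.21, 2.27, Lemma 1.8; [Perry2022] proof of Prop. 8.1; [Lieblich2006] Thm. 4.2.1; [Artin1969] Thm. 1.12;
[KodairaSpencer1959] (semi-regular divisors); [VoisinHodgeI2002] Thm. 11.30.
-/

-- every declaration of this problem lives in `Summit.HodgeConjecture.HodgeConjecture.…` (summit = sub-problem)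
set_option linter.dupNamespace false

noncomputable section

open CategoryTheory CategoryTheory.Limits AlgebraicGeometry
open Literature.AlgebraicGeometry.Motives Literature.AlgebraicGeometry.HodgeTheory
open Literature.AlgebraicGeometry.Deformation
open Summit.Ventures.HSemireg

namespace Summit.HodgeConjecture.HodgeConjecture.Cruxes.BFVariationalHodge.PridhamLiftsAlgebraise

/-- STUB (open, load-bearing, XL): (F) Pridham's refereed infinitesimal form — `I`-semiregular vector bundles lift over
Artinian points of the Hodge locus (tree named fact, by name). [cite: Pridham2024Semiregularity, Cor. 2.25, Rem. 2.27 and Lemma 1.8]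
[cite: BuchweitzFlenner2003, Prop. 5.9 and Lemma 5.10] -/
theorem stub_pridhamLifts : Pridham2024_ISemiregular_liftsOverHodgeLocus_model := by
  sorry

/-- STUB (open, load-bearing, XL): (E)+(C) Hodge-free algebraisation — a vector bundle with the formal lifting property
deforms over an étale neighbourhood with the prescribed Chern character, in every Chern character theory (venture
assumption, by name). [cite: Perry2022, proof of Prop. 8.1] [cite: Lieblich2006, Thm. 4.2.1] [cite: Artin1969, Thm. 1.12] -/
theorem stub_sheafAlgebraises : ∀ C : ChernCharacterBetti, SheafDeformsOverEtaleNbhdOfLifts C := by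
  sorry

/-- RUNG STUB (open, first prover target, M/L): Buchweitz–Flenner's Thm. 5.1 for INVERTIBLE sheaves (extra binder
`HasRankLE E₀ 1`), every `C` — decided in print by Lefschetz (1,1) / Kodaira–Spencer without the general deformation
theory. [cite: VoisinHodgeI2002, Thm. 11.30] [cite: KodairaSpencer1959, Thm. (stability of semi-regular divisors)] -/
theorem stub_rung_lineBundles :
    ∀ (C : ChernCharacterBetti) ⦃𝒳 S : SchemeOver ℂ⦄ (π : 𝒳 ⟶ S) (n : ℕ),
      IsSmoothProjectiveFamily π n → _root_.AlgebraicGeometry.Smooth S.hom →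
      ∀ ⦃U : Set (ComplexPoints S)⦄ (hU : IsCohomologicallyLocallyTrivialOn π U) (s₀ : U)
        (E₀ : (fiberOver π s₀.1).left.Modules) (hE₀ : IsFiniteLocallyFree E₀) (I : Finset ℕ),
        HasRankLE E₀ 1 →
        IsISemiregular hE₀ {q | q + 1 ∈ I} →
        (∀ p ∈ I, ∀ (t : U) (γ : Path.Homotopic.Quotient s₀ t),
            IsOfHodgeType n (fiberOver π t.1) (2 * p) p p
                (transportFun π (2 * p) hU γ (C.ch (fiberOver π s₀.1) E₀ p))) →
        ∃ (W : Set (ComplexPoints S)) (hWo : IsOpen W) (hW₀ : s₀.1 ∈ W) (hWU : W ⊆ U),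
          ∀ p ∈ I, ∀ (t : W) (γ : Path.Homotopic.Quotient (⟨s₀.1, hW₀⟩ : W) t),
            transportFun π (2 * p) (hU.mono hWU hWo) γ (C.ch (fiberOver π s₀.1) E₀ p) ∈
                algebraicClasses (fiberOver π t.1) p := by
  sorry

/-- Remark (sorry-free): the rung IS the crux restricted to invertible sheaves. -/
theorem rung_of_crux (h : Summit.HodgeConjecture.HodgeConjecture.Theses.KleimanBFSeeds.BFVariationalHodge) :
    ∀ (C : ChernCharacterBetti) ⦃𝒳 S : SchemeOver ℂ⦄ (π : 𝒳 ⟶ S) (n : ℕ),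
      IsSmoothProjectiveFamily π n → _root_.AlgebraicGeometry.Smooth S.hom →
      ∀ ⦃U : Set (ComplexPoints S)⦄ (hU : IsCohomologicallyLocallyTrivialOn π U) (s₀ : U)
        (E₀ : (fiberOver π s₀.1).left.Modules) (hE₀ : IsFiniteLocallyFree E₀) (I : Finset ℕ),
        HasRankLE E₀ 1 →
        IsISemiregular hE₀ {q | q + 1 ∈ I} →
        (∀ p ∈ I, ∀ (t : U) (γ : Path.Homotopic.Quotient s₀ t),
            IsOfHodgeType n (fiberOver π t.1) (2 * p) p p
                (transportFun π (2 * p) hU γ (C.ch (fiberOver π s₀.1) E₀ p))) →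
        ∃ (W : Set (ComplexPoints S)) (hWo : IsOpen W) (hW₀ : s₀.1 ∈ W) (hWU : W ⊆ U),
          ∀ p ∈ I, ∀ (t : W) (γ : Path.Homotopic.Quotient (⟨s₀.1, hW₀⟩ : W) t),
            transportFun π (2 * p) (hU.mono hWU hWo) γ (C.ch (fiberOver π s₀.1) E₀ p) ∈
                algebraicClasses (fiberOver π t.1) p :=
  fun C _ _ π n hπ hS _ hU s₀ E₀ hE₀ I _ hsr hHodge => h C π n hπ hS hU s₀ E₀ hE₀ I hsr hHodge

/-- **Composition** (the ONLY theorem of this file concluding the crux): the stubs give `BFVariationalHodge` BY NAME. -/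
theorem BFVariationalHodge_of :
    Summit.HodgeConjecture.HodgeConjecture.Theses.KleimanBFSeeds.BFVariationalHodge :=
  (BuchweitzFlenner2003_variationalHodge_ISemiregular_and_semiregular_of_pridham_of_sheafDeformsOverEtaleNbhdOfLifts
    stub_pridhamLifts stub_sheafAlgebraises).1

end Summit.HodgeConjecture.HodgeConjecture.Cruxes.BFVariationalHodge.PridhamLiftsAlgebraise

end
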